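import Literature.AlgebraicGeometry.Frobenioids.ArithmeticFrobenioidThm64ivNodeGeneral
import Literature.AlgebraicGeometry.Frobenioids.Prop53SubRlfIsFrobenioid
import Mathlib.FieldTheory.IsAlgClosed.AlgebraicClosure
import Mathlib.FieldTheory.IsSepClosed
import HarnessLib

/-!
# Frobenioids I, Theorem 6.4 (iv) (`Thm64iv`) HEAD-MATCHED AT THE CONSTRUCTIONS WITH NO HYPOTHESIS — PROOF-ONLY

Mochizuki, *The geometry of Frobenioids I: the general theory*, Kyushu J. Math. **62** (2008) 293–400, §6,
Theorem 6.4 (iv), kurims text p. 115: "Suppose that `Ψ^rlf` arises from an equivalence of categories `Ψ : C₁ ⥲ C₂`.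
Then `deg(Ψ^rlf) = 1`. If, moreover, there exists a finite extension `L₁ ⊆ F̃₁` of `F₁` which is Galois over `ℚ`, then
the corresponding [i.e., via the equivalence `D₁ ⥲ D₂` induced by `Ψ` — cf. (i); Corollary 4.11, (ii)] finite
extension `L₂ ⊆ F̃₂` of `F₂` is isomorphic to `L₁` in a fashion that is compatible with an isomorphism `F₁ ⥲ F₂`"
(setting of Thm. 6.4, p. 114: "For `i = 1, 2`, let `F_i` be a number field, `F̃_i/F_i` a [possibly infinite] Galois
extension, `G_i = Gal(F̃_i/F_i)`, `D_i = B(G_i)⁰`, `Φ_i` the monoid on `D_i` given by the effective arithmetic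
divisors, `B_i` the group-like monoid on `D_i` given by the multiplicative group of the field extension of `F_i` in
question, `B_i → Φ_i^gp` the natural map and `C_i` the associated model Frobenioid of Theorem 5.2, (ii)")
[cite: MochizukiFrdI2008, Thm. 6.4 (iv) p.115] [cite: MochizukiFrdI2008, Thm. 6.4 p.114]
(quoted from the kurims text; the journal printing, doi:10.2206/kyushujm.62.293 pp. 389–393, has the same words with
parentheses in place of the square brackets).

PROOF-ONLY companion (cell abc-iut, block F, seat abc-iut-f-001, KEY INST59K1; FROZEN FACT-LIST row F-0892 `Thm64iv` of
abc-iut-L1-t3's `ArithmeticFrobenioids.lean`; 0 `def`, 0 `instance`, 0 `structure`, no notation, nothing restated; the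
declaring file is imported — through abc-iut-L1-d3's `ArithmeticFrobenioidThm64ivNodeGeneral.lean` — never edited).

WHAT THE KERNEL RECORDS.  `Thm64iv R₁ R₂ Ψrlf picMap deg M₁ M₂ r₁ r₂ Ψ ΨBase` is a SCHEMA over free realification data
and a free `picMap`; its universal closure is FALSE (abc-iut-f-016 / abc-iut-L1-d2: `not_forall_Thm64iv`, replace
`picMap` by `-picMap`), and the closers of record are either conditional (`Thm64iv_of_generatorReadings`,
`Thm64iv_of_logNorm_transport_schema`, abc-iut-L1-t3) or the ∃-package `Thm64iv_schema_arith_general` (abc-iut-L1-d3: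
for EVERY equivalence `Ψ : C_{K₁/F₁} ⥲ C_{K₂/F₂}` of THE arithmetic Frobenioids there are THE induced `Ψ^Base`, `Ψ^rlf`,
`picMap` with `Thm64iv …` for every `deg`, `r₁`, `r₂`), which carries the perf-factoriality witnesses `hΦ_i` of the
realifications as HYPOTHESES.  (abc-iut-L1-d2's head-matched `Thm64iv_arith_inst`, same hypotheses, is accepted but its
module has no built object yet.)  This file states the schema as conclusion HEAD with NO hypothesis at all: the
witnesses are THE tree's theorem `arithDivisorFunctor_isPerfFactorialOn F K` (abc-iut-L1-d1, Ex. 6.3 "`Φ(L)` … is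
perf-factorial"), the packaged data are NAMED by `Exists.choose`, and every remaining binder is universal:
* for EVERY pair of Galois extensions of number fields `K₁/F₁`, `K₂/F₂` (the schema's own binders plus print's
  "`F̃_i/F_i` … Galois") and EVERY `Ψ`, `deg`, `r₁`, `r₂` (`Thm64iv_arith_inst_unconditional`);
* at `F₁ = F₂ = ℚ`, `F̃ = ℚ̄` (`AlgebraicClosure ℚ`; the Frobenioid `C_{ℚ̄/ℚ}`), for EVERY self-equivalence `Ψ` of
  `C_{ℚ̄/ℚ}` and every `deg`, `r₁`, `r₂` — every type binder closed (`Thm64iv_arith_inst_rat_algebraicClosure`; "`ℚ̄/ℚ`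
  is Galois" is passed by name across the reducible-transparency ℚ-algebra diamond, no instance declared), and the same
  at `Ψ = 𝟭` the identity self-equivalence (`…_refl`: only the schema's free `deg`, `r₁`, `r₂` remain);
* for every number field `F` with `F̃ = F̄` and every self-equivalence of `C_{F̄/F}` (`Thm64iv_arith_inst_algebraicClosure`).

An instance-form theorem about OUR typed statement ≠ a theorem about [FrdI] in print; classical, undisputed mathematics;
nothing here bears on [IUTchIII] Cor. 3.12 or asserts anything about abc; no statement of the paper is strengthened;
typed ≠ proved for anything not in this file.
-/

noncomputable section

namespace Literature.AlgebraicGeometry.Frobenioids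

open CategoryTheory

section General

variable {F₁ : Type} [Field F₁] [NumberField F₁] {K₁ : Type} [Field K₁] [Algebra F₁ K₁] [IsGalois F₁ K₁]
  {F₂ : Type} [Field F₂] [NumberField F₂] {K₂ : Type} [Field K₂] [Algebra F₂ K₂] [IsGalois F₂ K₂]
  (Ψ : arithFrobenioid F₁ K₁ ≌ arithFrobenioid F₂ K₂)

/-- **F-0892 / [FrdI] Theorem 6.4 (iv) AS TYPED (`Thm64iv`), AT THE CONSTRUCTIONS, NO HYPOTHESIS**: for Galois
extensions of number fields `K_i/F_i`, THE realifications `C_{K_i/F_i}^rlf` with THE `Pic_Φ`, `δ_A` of Thm. 6.4 (i)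
(`arithRealification`, perf-factoriality by `arithDivisorFunctor_isPerfFactorialOn`), THE models `arithModelFrobenioid`,
and EVERY equivalence `Ψ : C_{K₁/F₁} ⥲ C_{K₂/F₂}`: at THE induced `Ψ^rlf`, `picMap` and `Ψ^Base` (components of
abc-iut-L1-d3's ∃-package `Thm64iv_schema_arith_general`, named by `Exists.choose`) the schema holds for every `deg` and
all comparison functors `r₁`, `r₂` — "`deg(Ψ^rlf) = 1`", and every `L₁` Galois over `ℚ` corresponds via `Ψ^Base` to
`L₂ ≅ L₁` compatibly with an isomorphism `F₁ ⥲ F₂`. [cite: MochizukiFrdI2008, Thm. 6.4 (iv) p.115] -/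
theorem Thm64iv_arith_inst_unconditional (deg : ℝ)
    (r₁ : arithFrobenioid F₁ K₁ ⥤ PreFrobenioid.rlf (ModelFrobenioid.toElem (arithDivisorFunctor F₁ K₁)
      (unitsFunctor F₁ K₁) (divNatTrans F₁ K₁)) (arithDivisorFunctor_isPerfFactorialOn F₁ K₁))
    (r₂ : arithFrobenioid F₂ K₂ ⥤ PreFrobenioid.rlf (ModelFrobenioid.toElem (arithDivisorFunctor F₂ K₂)
      (unitsFunctor F₂ K₂) (divNatTrans F₂ K₂)) (arithDivisorFunctor_isPerfFactorialOn F₂ K₂)) :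
    Thm64iv (arithRealification (arithDivisorFunctor_isPerfFactorialOn F₁ K₁))
      (arithRealification (arithDivisorFunctor_isPerfFactorialOn F₂ K₂))
      (Thm64iv_schema_arith_general (arithDivisorFunctor_isPerfFactorialOn F₁ K₁)
        (arithDivisorFunctor_isPerfFactorialOn F₂ K₂) Ψ).choose_spec.choose_spec.choose_spec.choose
      (Thm64iv_schema_arith_general (arithDivisorFunctor_isPerfFactorialOn F₁ K₁)
        (arithDivisorFunctor_isPerfFactorialOn F₂ K₂) Ψ).choose_spec.choose_spec.choose_spec.choose_spec.choose
      deg (arithModelFrobenioid F₁ K₁) (arithModelFrobenioid F₂ K₂) r₁ r₂ Ψ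
      (Thm64iv_schema_arith_general (arithDivisorFunctor_isPerfFactorialOn F₁ K₁)
        (arithDivisorFunctor_isPerfFactorialOn F₂ K₂) Ψ).choose :=
  (Thm64iv_schema_arith_general (arithDivisorFunctor_isPerfFactorialOn F₁ K₁)
    (arithDivisorFunctor_isPerfFactorialOn F₂ K₂) Ψ).choose_spec.choose_spec.choose_spec.choose_spec.choose_spec.2.2
      deg r₁ r₂

end General

/-- **F-0892 at `F₁ = F₂ = ℚ`, `F̃ = ℚ̄`, every type binder closed**: for THE arithmetic Frobenioid `C_{ℚ̄/ℚ}` of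
Ex. 6.3 / Thm. 6.4 (effective arithmetic divisors over `D = B(Gal(ℚ̄/ℚ))⁰`), its realification with THE `Pic_Φ`, `δ_A`,
and EVERY self-equivalence `Ψ : C_{ℚ̄/ℚ} ⥲ C_{ℚ̄/ℚ}`: the typed Thm. 6.4 (iv) holds at THE induced `Ψ^rlf`, `picMap`,
`Ψ^Base`, for every `deg`, `r₁`, `r₂` ("`ℚ̄/ℚ` is Galois": an algebraic closure of a perfect field is a separable closure).
[cite: MochizukiFrdI2008, Thm. 6.4 (iv) p.115] -/
theorem Thm64iv_arith_inst_rat_algebraicClosure :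
    haveI : IsGalois ℚ (AlgebraicClosure ℚ) :=
      @IsSepClosure.isGalois ℚ _ (AlgebraicClosure ℚ) _ _
        (@IsSepClosure.of_isAlgClosure_of_perfectField ℚ _ (AlgebraicClosure ℚ) _ _
          (AlgebraicClosure.instIsAlgClosure ℚ) _)
    ∀ (Ψ : arithFrobenioid ℚ (AlgebraicClosure ℚ) ≌ arithFrobenioid ℚ (AlgebraicClosure ℚ)) (deg : ℝ)
      (r₁ r₂ : arithFrobenioid ℚ (AlgebraicClosure ℚ) ⥤ PreFrobenioid.rlf (ModelFrobenioid.toElem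
        (arithDivisorFunctor ℚ (AlgebraicClosure ℚ)) (unitsFunctor ℚ (AlgebraicClosure ℚ))
        (divNatTrans ℚ (AlgebraicClosure ℚ))) (arithDivisorFunctor_isPerfFactorialOn ℚ (AlgebraicClosure ℚ))),
      Thm64iv (arithRealification (arithDivisorFunctor_isPerfFactorialOn ℚ (AlgebraicClosure ℚ)))
        (arithRealification (arithDivisorFunctor_isPerfFactorialOn ℚ (AlgebraicClosure ℚ)))
        (Thm64iv_schema_arith_general (arithDivisorFunctor_isPerfFactorialOn ℚ (AlgebraicClosure ℚ))
          (arithDivisorFunctor_isPerfFactorialOn ℚ (AlgebraicClosure ℚ)) Ψ).choose_spec.choose_spec.choose_spec.choose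
        (Thm64iv_schema_arith_general (arithDivisorFunctor_isPerfFactorialOn ℚ (AlgebraicClosure ℚ))
          (arithDivisorFunctor_isPerfFactorialOn ℚ (AlgebraicClosure ℚ))
            Ψ).choose_spec.choose_spec.choose_spec.choose_spec.choose
        deg (arithModelFrobenioid ℚ (AlgebraicClosure ℚ)) (arithModelFrobenioid ℚ (AlgebraicClosure ℚ)) r₁ r₂ Ψ
        (Thm64iv_schema_arith_general (arithDivisorFunctor_isPerfFactorialOn ℚ (AlgebraicClosure ℚ))
          (arithDivisorFunctor_isPerfFactorialOn ℚ (AlgebraicClosure ℚ)) Ψ).choose := by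
  haveI : IsGalois ℚ (AlgebraicClosure ℚ) :=
    @IsSepClosure.isGalois ℚ _ (AlgebraicClosure ℚ) _ _
      (@IsSepClosure.of_isAlgClosure_of_perfectField ℚ _ (AlgebraicClosure ℚ) _ _
        (AlgebraicClosure.instIsAlgClosure ℚ) _)
  intro Ψ deg r₁ r₂
  exact Thm64iv_arith_inst_unconditional Ψ deg r₁ r₂

/-- **F-0892 at `F₁ = F₂ = ℚ`, `F̃ = ℚ̄`, `Ψ =` the identity self-equivalence of `C_{ℚ̄/ℚ}`** — every binder but the
schema's free `deg`, `r₁`, `r₂` closed: the typed Thm. 6.4 (iv) at THE data induced by `Ψ = 𝟭`.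
[cite: MochizukiFrdI2008, Thm. 6.4 (iv) p.115] -/
theorem Thm64iv_arith_inst_rat_algebraicClosure_refl :
    haveI : IsGalois ℚ (AlgebraicClosure ℚ) :=
      @IsSepClosure.isGalois ℚ _ (AlgebraicClosure ℚ) _ _
        (@IsSepClosure.of_isAlgClosure_of_perfectField ℚ _ (AlgebraicClosure ℚ) _ _
          (AlgebraicClosure.instIsAlgClosure ℚ) _)
    ∀ (deg : ℝ)
      (r₁ r₂ : arithFrobenioid ℚ (AlgebraicClosure ℚ) ⥤ PreFrobenioid.rlf (ModelFrobenioid.toElem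
        (arithDivisorFunctor ℚ (AlgebraicClosure ℚ)) (unitsFunctor ℚ (AlgebraicClosure ℚ))
        (divNatTrans ℚ (AlgebraicClosure ℚ))) (arithDivisorFunctor_isPerfFactorialOn ℚ (AlgebraicClosure ℚ))),
      Thm64iv (arithRealification (arithDivisorFunctor_isPerfFactorialOn ℚ (AlgebraicClosure ℚ)))
        (arithRealification (arithDivisorFunctor_isPerfFactorialOn ℚ (AlgebraicClosure ℚ)))
        (Thm64iv_schema_arith_general (arithDivisorFunctor_isPerfFactorialOn ℚ (AlgebraicClosure ℚ))
          (arithDivisorFunctor_isPerfFactorialOn ℚ (AlgebraicClosure ℚ))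
          (CategoryTheory.Equivalence.refl (C := arithFrobenioid ℚ (AlgebraicClosure ℚ)))
            ).choose_spec.choose_spec.choose_spec.choose
        (Thm64iv_schema_arith_general (arithDivisorFunctor_isPerfFactorialOn ℚ (AlgebraicClosure ℚ))
          (arithDivisorFunctor_isPerfFactorialOn ℚ (AlgebraicClosure ℚ))
          (CategoryTheory.Equivalence.refl (C := arithFrobenioid ℚ (AlgebraicClosure ℚ)))
            ).choose_spec.choose_spec.choose_spec.choose_spec.choose
        deg (arithModelFrobenioid ℚ (AlgebraicClosure ℚ)) (arithModelFrobenioid ℚ (AlgebraicClosure ℚ)) r₁ r₂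
        (CategoryTheory.Equivalence.refl (C := arithFrobenioid ℚ (AlgebraicClosure ℚ)))
        (Thm64iv_schema_arith_general (arithDivisorFunctor_isPerfFactorialOn ℚ (AlgebraicClosure ℚ))
          (arithDivisorFunctor_isPerfFactorialOn ℚ (AlgebraicClosure ℚ))
          (CategoryTheory.Equivalence.refl (C := arithFrobenioid ℚ (AlgebraicClosure ℚ)))).choose := by
  haveI : IsGalois ℚ (AlgebraicClosure ℚ) :=
    @IsSepClosure.isGalois ℚ _ (AlgebraicClosure ℚ) _ _
      (@IsSepClosure.of_isAlgClosure_of_perfectField ℚ _ (AlgebraicClosure ℚ) _ _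
        (AlgebraicClosure.instIsAlgClosure ℚ) _)
  intro deg r₁ r₂
  exact Thm64iv_arith_inst_unconditional _ deg r₁ r₂

/-- **F-0892 for every number field `F` with `F̃ = F̄`** and every self-equivalence `Ψ` of `C_{F̄/F}`: the typed
Thm. 6.4 (iv) at THE induced data, for every `deg`, `r₁`, `r₂`. [cite: MochizukiFrdI2008, Thm. 6.4 (iv) p.115] -/
theorem Thm64iv_arith_inst_algebraicClosure (F : Type) [Field F] [NumberField F]
    (Ψ : arithFrobenioid F (AlgebraicClosure F) ≌ arithFrobenioid F (AlgebraicClosure F)) (deg : ℝ)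
    (r₁ r₂ : arithFrobenioid F (AlgebraicClosure F) ⥤ PreFrobenioid.rlf (ModelFrobenioid.toElem
      (arithDivisorFunctor F (AlgebraicClosure F)) (unitsFunctor F (AlgebraicClosure F))
      (divNatTrans F (AlgebraicClosure F))) (arithDivisorFunctor_isPerfFactorialOn F (AlgebraicClosure F))) :
    Thm64iv (arithRealification (arithDivisorFunctor_isPerfFactorialOn F (AlgebraicClosure F)))
      (arithRealification (arithDivisorFunctor_isPerfFactorialOn F (AlgebraicClosure F)))
      (Thm64iv_schema_arith_general (arithDivisorFunctor_isPerfFactorialOn F (AlgebraicClosure F))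
        (arithDivisorFunctor_isPerfFactorialOn F (AlgebraicClosure F)) Ψ).choose_spec.choose_spec.choose_spec.choose
      (Thm64iv_schema_arith_general (arithDivisorFunctor_isPerfFactorialOn F (AlgebraicClosure F))
        (arithDivisorFunctor_isPerfFactorialOn F (AlgebraicClosure F))
          Ψ).choose_spec.choose_spec.choose_spec.choose_spec.choose
      deg (arithModelFrobenioid F (AlgebraicClosure F)) (arithModelFrobenioid F (AlgebraicClosure F)) r₁ r₂ Ψ
      (Thm64iv_schema_arith_general (arithDivisorFunctor_isPerfFactorialOn F (AlgebraicClosure F))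
        (arithDivisorFunctor_isPerfFactorialOn F (AlgebraicClosure F)) Ψ).choose :=
  Thm64iv_arith_inst_unconditional Ψ deg r₁ r₂

end Literature.AlgebraicGeometry.Frobenioids

end
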